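import Mathlib
import Summits.CriticalPhenomena.CardyFormulaZ2.Theorems.CardyFlipRussoSquareFromVoronoiHubDefs
import Summits.CriticalPhenomena.CardyFormulaZ2.Theorems.CardyFlipRussoSquareFromVoronoiHubChessboardDefs
import Summits.CriticalPhenomena.CardyFormulaZ2.Theorems.CardyFlipRussoSquareFromVoronoiHubSmallCellsPart1
import Literature.Probability.Percolation.VoronoiCrossing
import Literature.Analysis.FunctionSpaces.PoissonPointProcess
import Literature.Analysis.FunctionSpaces.PoissonMecke
import Literature.Analysis.FunctionSpaces.PoissonPointProcessExistence
import Literature.Analysis.FunctionSpaces.PoissonPointProcessUniqueness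
import HarnessLib

/-!
# Stub `stub_hypothesisEnd` of line `Sketch` (r2 k4, card `poissonised-chessboard`), crux `SquareFromVoronoiHub`
# (stmt-CriticalPhenomena-6434, route `CardyFlipRusso`, sub-problem `CardyFormulaZ2`)

The HYPOTHESIS END (`u = 0`) of the poissonised-chessboard leg of
`…CardyFlipRussoSquareFromVoronoiHubChessboardDefs.lean`.  If the block-type nuclei `ω.1.2` have the
Poisson law `PK` of intensity the ZERO measure, then `PK`-almost surely there is no block-type nucleus
at all (the void probability of the whole plane is `e^{-0} = 1`, `measure_count_univ_eq_zero_of_zero`),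
so on the co-null measurable cylinder `{ω | N_{ω.1.2}(ℂ) = 0}` the leg's colour classes
`blackNuclei m ω`, `whiteNuclei m ω` are just the free black / free white nuclei `ω.1.1.1`, `ω.1.1.2`,
and there the leg's crossing event `legCrossing R m s` coincides with the cylinder over the crux's
Poisson–Voronoi crossing event (the integrand of `voronoiCrossingProb`).  By outer-measure bookkeeping
(`measure_inter_conull` and `Measure.prod_prod`, neither of which needs the crossing event to be
measurable) `legProb PBf PWf PK R m s = voronoiCrossingProb PBf PWf R s` for EVERY block side `m` and
nucleus scale `s` (`legProb_eq_voronoiCrossingProb`, the heart of the file), and Cardy's formula for the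
crux's hypothesis sequence transfers to the leg along the reparametrisation `δ ↦ s(δ) → 0⁺`
(`tendsto_sOf`): the registered stub `stub_hypothesisEnd`.

References: B. Bollobás, O. Riordan, *Percolation* (CUP 2006), Ch. 8 §8.2 (annealed random Voronoi
percolation, crossing events); J. F. C. Kingman, *Poisson Processes* (1993), §2.1 (void probabilities);
the card `Cruxes/SquareFromVoronoiHub/Ideas/poissonised-chessboard.md`.
-/

noncomputable section

open scoped Topology
open Filter Set MeasureTheory Metric
open Literature.Analysis.FunctionSpaces (PointConfig IsPoissonPointProcess)
open Literature.Probability.RandomPlanarGeometry (ConformalRectangle cardyFunction crossRatio)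
open Literature.Probability.Percolation (SiteConfig sitePercolation half voronoiCrossing blackRegion)
open Summit.CriticalPhenomena.CardyFormulaZ2.Cruxes.SquareFromVoronoiHub.VoronoiBlocks
  (zGs Gs crudeCrossing siteCrossingProb voronoiCrossingProb squareFromVoronoiHub_iff)
open Summit.CriticalPhenomena.CardyFormulaZ2.Cruxes.SquareFromVoronoiHub.VoronoiBlocks.SmallCells
  (count_univ_eq_zero_iff)

namespace Summit.CriticalPhenomena.CardyFormulaZ2.Cruxes.SquareFromVoronoiHub.PoissonisedChessboard

/-! ### At intensity zero there is almost surely no block-type nucleus -/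

/-- The event "the configuration is empty" (`N(univ) = 0`) is measurable for the count σ-algebra
(Kingman 1993, §2.1). [folklore] -/
theorem measurableSet_count_univ_eq_zero :
    MeasurableSet {c : PointConfig ℂ | c.count univ = 0} :=
  PointConfig.measurable_count MeasurableSet.univ (measurableSet_singleton 0)

/-- Under the Poisson law of intensity ZERO the configuration is almost surely empty: the void
probability of the whole plane is `e^{-0} = 1` (Kingman 1993, §2.1). [folklore] -/
theorem measure_count_univ_eq_zero_of_zero {PK : Measure (PointConfig ℂ)}
    (hK : IsPoissonPointProcess (0 : Measure ℂ) PK) : PK {c | c.count univ = 0} = 1 := by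
  rw [hK.measure_count_eq_zero MeasurableSet.univ (by simp)]
  simp

/-- Under the Poisson law of intensity ZERO, "some nucleus exists" is a null event. [folklore] -/
theorem measure_compl_count_univ_eq_zero_of_zero {PK : Measure (PointConfig ℂ)}
    (hK : IsPoissonPointProcess (0 : Measure ℂ) PK) : PK {c | c.count univ = 0}ᶜ = 0 := by
  haveI := hK.isProbabilityMeasure
  exact (prob_compl_eq_zero_iff measurableSet_count_univ_eq_zero).2
    (measure_count_univ_eq_zero_of_zero hK)

/-- Under the annealed law of the leg with block-type intensity ZERO, "some block-type nucleus exists"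
is a null event (a cylinder over a `PK`-null set; `Measure.prod_prod`). [folklore] -/
theorem legMeasure_compl_noBlockNuclei_eq_zero (PBf PWf : Measure (PointConfig ℂ))
    {PK : Measure (PointConfig ℂ)} (hK : IsPoissonPointProcess (0 : Measure ℂ) PK) :
    legMeasure PBf PWf PK {ω : LegConfig | ω.1.2.count univ = 0}ᶜ = 0 := by
  haveI := hK.isProbabilityMeasure
  have hcyl : ({ω : LegConfig | ω.1.2.count univ = 0}ᶜ : Set LegConfig) =
      ((univ : Set (PointConfig ℂ × PointConfig ℂ)) ×ˢ {c : PointConfig ℂ | c.count univ = 0}ᶜ) ×ˢ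
        (univ : Set (SiteConfig ((ℤ × ℤ) ⊕ (ℤ × ℤ)))) := by
    ext ω
    simp
  rw [hcyl, legMeasure, Measure.prod_prod, Measure.prod_prod,
    measure_compl_count_univ_eq_zero_of_zero hK, mul_zero, zero_mul]

/-! ### Without block-type nuclei the colour classes are the free nuclei -/

/-- If there is no block-type nucleus, the black nuclei are the free black nuclei. [folklore] -/
theorem blackNuclei_eq_of_count_eq_zero {m : ℝ} {ω : LegConfig} (hω : ω.1.2.count univ = 0) :
    blackNuclei m ω = (ω.1.1.1 : Set ℂ) := by
  have h0 : (ω.1.2 : Set ℂ) = ∅ := (count_univ_eq_zero_iff _).1 hω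
  ext x
  simp only [mem_blackNuclei, h0, mem_empty_iff_false, false_and, or_false]

/-- If there is no block-type nucleus, the white nuclei are the free white nuclei. [folklore] -/
theorem whiteNuclei_eq_of_count_eq_zero {m : ℝ} {ω : LegConfig} (hω : ω.1.2.count univ = 0) :
    whiteNuclei m ω = (ω.1.1.2 : Set ℂ) := by
  have h0 : (ω.1.2 : Set ℂ) = ∅ := (count_univ_eq_zero_iff _).1 hω
  ext x
  simp only [mem_whiteNuclei, h0, mem_empty_iff_false, false_and, or_false]

/-- On the cylinder "no block-type nucleus" the leg's crossing event is the cylinder over the crux's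
Poisson–Voronoi crossing event of the free nuclei. [cite: BollobasRiordan2006, Ch. 8 §8.2] -/
theorem legCrossing_inter_noBlockNuclei (R : ConformalRectangle) (m s : ℝ) :
    legCrossing R m s ∩ {ω : LegConfig | ω.1.2.count univ = 0} =
      (({c : PointConfig ℂ × PointConfig ℂ |
          voronoiCrossing R.carrier (R.arc 0) (R.arc 2) s (c.1 : Set ℂ) (c.2 : Set ℂ)} ×ˢ
          (univ : Set (PointConfig ℂ))) ×ˢ (univ : Set (SiteConfig ((ℤ × ℤ) ⊕ (ℤ × ℤ))))) ∩
        {ω : LegConfig | ω.1.2.count univ = 0} := by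
  ext ω
  refine and_congr_left fun hω => ?_
  have hω' : ω.1.2.count univ = 0 := hω
  simp only [legCrossing, mem_setOf_eq, blackNuclei_eq_of_count_eq_zero hω',
    whiteNuclei_eq_of_count_eq_zero hω', mem_prod, mem_univ, and_true]

/-! ### The heart: at `u = 0` the leg probability IS the crux's hypothesis probability -/

/-- **The `u = 0` leg is the hypothesis model, for every block side.**  If the block-type nuclei have
the Poisson law of intensity zero, then for every conformal rectangle `R`, every block side `m` and
every nucleus scale `s`, `legProb PBf PWf PK R m s = voronoiCrossingProb PBf PWf R s` (outer measures:
intersect with the co-null measurable cylinder "no block-type nucleus", on which the two events agree,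
and factor the cylinder with `Measure.prod_prod`). [cite: BollobasRiordan2006, Ch. 8 §8.2] -/
theorem legProb_eq_voronoiCrossingProb (PBf PWf : Measure (PointConfig ℂ)) {PK : Measure (PointConfig ℂ)}
    (hK : IsPoissonPointProcess (0 : Measure ℂ) PK) (R : ConformalRectangle) (m s : ℝ) :
    legProb PBf PWf PK R m s = voronoiCrossingProb PBf PWf R s := by
  haveI := hK.isProbabilityMeasure
  have hG := legMeasure_compl_noBlockNuclei_eq_zero PBf PWf hK
  unfold legProb voronoiCrossingProb
  simp only [measureReal_def]
  congr 1
  calc legMeasure PBf PWf PK (legCrossing R m s)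
      = legMeasure PBf PWf PK (legCrossing R m s ∩ {ω : LegConfig | ω.1.2.count univ = 0}) :=
        (measure_inter_conull hG).symm
    _ = legMeasure PBf PWf PK
          ((({c : PointConfig ℂ × PointConfig ℂ |
              voronoiCrossing R.carrier (R.arc 0) (R.arc 2) s (c.1 : Set ℂ) (c.2 : Set ℂ)} ×ˢ
              (univ : Set (PointConfig ℂ))) ×ˢ (univ : Set (SiteConfig ((ℤ × ℤ) ⊕ (ℤ × ℤ))))) ∩
            {ω : LegConfig | ω.1.2.count univ = 0}) := by
        rw [legCrossing_inter_noBlockNuclei]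
    _ = legMeasure PBf PWf PK
          (({c : PointConfig ℂ × PointConfig ℂ |
              voronoiCrossing R.carrier (R.arc 0) (R.arc 2) s (c.1 : Set ℂ) (c.2 : Set ℂ)} ×ˢ
              (univ : Set (PointConfig ℂ))) ×ˢ (univ : Set (SiteConfig ((ℤ × ℤ) ⊕ (ℤ × ℤ))))) :=
        measure_inter_conull hG
    _ = (PBf.prod PWf) {c : PointConfig ℂ × PointConfig ℂ |
          voronoiCrossing R.carrier (R.arc 0) (R.arc 2) s (c.1 : Set ℂ) (c.2 : Set ℂ)} := by
        rw [legMeasure, Measure.prod_prod, Measure.prod_prod, measure_univ, measure_univ, mul_one,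
          mul_one]

/-- **The hypothesis end as a function of the mesh**: along the schedule `m = mOf δ`, `s = sOf δ` the
`u = 0` leg probability is the crux's hypothesis probability read at scale `s(δ)`. [folklore] -/
theorem legProb_schedule_eq (PBf PWf : Measure (PointConfig ℂ)) {PK : Measure (PointConfig ℂ)}
    (hK : IsPoissonPointProcess (0 : Measure ℂ) PK) (R : ConformalRectangle) :
    (fun δ => legProb PBf PWf PK R (mOf δ) (sOf δ)) = voronoiCrossingProb PBf PWf R ∘ sOf :=
  funext fun δ => legProb_eq_voronoiCrossingProb PBf PWf hK R (mOf δ) (sOf δ)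

/-! ### Registered stub -/

/-- **Registered stub `stub_hypothesisEnd`** (the HYPOTHESIS END of the poissonised-chessboard leg):
under the crux's hypothesis — Cardy's formula for the annealed Poisson–Voronoi crossing probabilities
`voronoiCrossingProb PB PW R` of every conformal rectangle, for every pair of Poisson laws of Lebesgue
intensity — the `u = 0` leg probabilities `δ ↦ legProb PBf PWf PK R (m(δ)) (s(δ))` (free nuclei
Poisson of Lebesgue intensity, block-type nuclei Poisson of intensity ZERO, fair block coins) tend to
Cardy's `F(η)` as `δ → 0⁺`: almost surely there is no block-type nucleus, so the leg probability equals
`voronoiCrossingProb PBf PWf R (s(δ))` (`legProb_eq_voronoiCrossingProb`), and `s(δ) → 0⁺`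
(`tendsto_sOf`). [cite: BollobasRiordan2006, Ch. 8 §8.2] -/
theorem stub_hypothesisEnd : (∀ (PB PW : Measure (PointConfig ℂ)),
      IsPoissonPointProcess (volume : Measure ℂ) PB → IsPoissonPointProcess (volume : Measure ℂ) PW →
      ∀ R : ConformalRectangle, R.HasCrossingLimit (voronoiCrossingProb PB PW R) cardyFunction) →
    ∀ (PBf PWf PK : Measure (PointConfig ℂ)),
      IsPoissonPointProcess (volume : Measure ℂ) PBf → IsPoissonPointProcess (volume : Measure ℂ) PWf →
      IsPoissonPointProcess (0 : Measure ℂ) PK →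
      ∀ R : ConformalRectangle,
        R.HasCrossingLimit (fun δ => legProb PBf PWf PK R (mOf δ) (sOf δ)) cardyFunction := by
  intro hV PBf PWf PK hBf hWf hK R φ x hux
  rw [legProb_schedule_eq PBf PWf hK R]
  exact (hV PBf PWf hBf hWf R φ x hux).comp tendsto_sOf

end Summit.CriticalPhenomena.CardyFormulaZ2.Cruxes.SquareFromVoronoiHub.PoissonisedChessboard

end
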